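import Summits.Langlands.Langlands.Theorems.MonomialSerreAtSplitPrimes.Negative.RatPlacesTestIdele

/-!
# `SplitPrimeInduction.MonomialSerreAtSplitPrimes` (stmt-Langlands-16951) is false on its even-real sector

Part 3 (conclusion) of the chain (refuter, crux attack at birth, 2026-08-17; supports
stmt-Langlands-16951): `monomialSerreAtSplitPrimes_false_of_cubicField` — the crux fails for every
number field `F` of degree `3` with `r₁(F) ≤ 1`, an odd prime `p` completely split in `F`, and a modulus
`M₀ > 0` (and bound `B₀`) such that every prime `ℓ > B₀`, `ℓ ≡ -1 (mod M₀)`, has exactly two places of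
`F` above `(ℓ)`, of residue degrees `1` and `2` over `𝓞 ℚ`.  These hypotheses hold for `F = ℚ(∛2)`,
`p = 31`, `M₀ = B₀ = 3` (Dedekind–Kummer; supplied by a separate file), which makes the crux FALSE as
stated: it is MISSTATED (it quantifies over all characters `χ` of `Γ_F`; the even ones at the real place
cannot occur), repair = insert `χ.IsOdd` — the planner's `Birth.MonomialSerreAtSplitPrimesOdd`.

MECHANISM (the planner's kill criterion in `Cruxes/MonomialSerreAtSplitPrimes/RefutationSketch.md`,
sharpened to a single Dirichlet prime).  Take `χ = 1`.  By part I the Hecke operator of a principal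
scalar idèle `r·1`, `r ∈ ℚ^×`, is the identity, and Hecke operators only see the coset `gK'`.  The top
operator `T^{(3)}_ℓ` is the scalar of the local idèle `ϖ_ℓ = (-ℓ) · y` with `y = (-ℓ)⁻¹ ϖ_ℓ` integral
everywhere and `≡ 1` to any prescribed depth at any prescribed finite set of places as soon as `ℓ ≡ -1`
modulo a suitable modulus (part II); openness of the level `K'` (part I §3) then puts `y·1 ∈ K'`, so
`T^{(3)}_ℓ e = e` and `b_{ℓ,3} = 1` for a Dirichlet prime `ℓ ∉ S'` (Mathlib
`Nat.forall_exists_prime_gt_and_eq_mod`).  The `X³`-coefficient of the asserted identity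
`P_ℓ(b) = ∏_{w∣ℓ}(1 - X^{f_w})` reads `-ℓ⁶ b_{ℓ,3} = +1` when `(ℓ)` has two places of degrees `1, 2`
above it; with `ℓ ≡ -1 (mod p)` this is `-1 = 1` in `k = 𝔽̄_p`, `p` odd: contradiction.  (Over a field
with one real place the sign `(-1)^{#places}` is the ODD character `sgn(Frob_ℓ)`; that is why the even
character `χ = 1` cannot occur.)

References: P. Scholze, Ann. of Math. 182 (2015) §V.4 [Scholze2015]; H. Cohen, GTM 138 (1993) §4.8.2,
§6.4 [Cohen1993].
-/

noncomputable section

set_option linter.dupNamespace false -- `Summit.Langlands.Langlands` is the mandated namespace (D-0017)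

open scoped NumberField Classical Polynomial Topology RestrictedProduct
open IsDedekindDomain NumberField Polynomial Filter
open Literature.NumberTheory.Automorphic Literature.NumberTheory.GaloisRepresentations

namespace Summit.Langlands.Langlands.Theorems.MonomialSerreAtSplitPrimes.Negative

/-! ## 5. Auxiliary facts for the contradiction -/

/-- The trivial character `1 : Γ_F → GL₁(k)` is unramified at every finite place, with Frobenius
polynomial `X - 1`. [folklore] -/
theorem trivial_unramified_frobOne (F : Type) [Field F] [NumberField F] (k : Type) [Field k]
    [TopologicalSpace k] (w : HeightOneSpectrum (𝓞 F)) :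
    (1 : FramedGaloisRep F k 1).IsUnramifiedAt w ∧
      (1 : FramedGaloisRep F k 1).HasFrobCharpolyAt w (X - C (1 : k)) := by
  refine ⟨fun 𝔓 _ σ _ => rfl, fun 𝔓 _ σ _ => ?_⟩
  show Matrix.charpoly (((1 : FramedGaloisRep F k 1) σ : GL (Fin 1) k) : Matrix (Fin 1) (Fin 1) k) =
    X - C 1
  simp [Matrix.charpoly_one]

/-- `2 ≠ 0` in a ring of prime characteristic `p ≠ 2`. [folklore] -/
theorem two_ne_zero_of_charP (k : Type) [Field k] (p : ℕ) [Fact p.Prime] [CharP k p] (hp : p ≠ 2) :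
    (2 : k) ≠ 0 := by
  intro h
  have h' : ((2 : ℕ) : k) = 0 := by exact_mod_cast h
  rw [CharP.cast_eq_zero_iff k p 2] at h'
  exact hp ((Nat.prime_dvd_prime_iff_eq (Fact.out : p.Prime) Nat.prime_two).1 h')

/-- The `X³`-coefficient of the crux's Hecke polynomial in rank `3`. [folklore] -/
theorem coeff_three_heckePoly {k : Type} [Field k] (q : ℕ) (b : ℕ → k) :
    (1 + ∑ j ∈ Finset.Icc 1 3, C ((-1 : k) ^ j * (q : k) ^ (j * (j + 1) / 2) * b j) * X ^ j :
      Polynomial k).coeff 3 = -((q : k) ^ 6 * b 3) := by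
  rw [Polynomial.coeff_add, Polynomial.coeff_one, Polynomial.finsetSum_coeff,
    Finset.sum_eq_single_of_mem 3 (by simp) fun j _ hj => by
      rw [Polynomial.coeff_C_mul, Polynomial.coeff_X_pow, if_neg (fun h => hj h.symm), mul_zero],
    Polynomial.coeff_C_mul, Polynomial.coeff_X_pow, if_pos rfl, mul_one]
  norm_num

/-- The `X³`-coefficient of `(1 - X)(1 - X²)` is `1`. [folklore] -/
theorem coeff_three_oneSubX_mul {k : Type} [Field k] :
    ((1 - C (1 : k)⁻¹ * X ^ 1) * (1 - C (1 : k)⁻¹ * X ^ 2) : Polynomial k).coeff 3 = 1 := by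
  have : ((1 - C (1 : k)⁻¹ * X ^ 1) * (1 - C (1 : k)⁻¹ * X ^ 2) : Polynomial k) =
      1 - X - X ^ 2 + X ^ 3 := by
    simp only [inv_one, map_one, one_mul, pow_one]
    ring
  rw [this]
  simp [Polynomial.coeff_one, Polynomial.coeff_X_pow, Polynomial.coeff_X]

/-! ## 6. The theorem: the crux fails for every complex cubic field with a completely split odd prime
whose primes `ℓ ≡ -1 (mod M₀)` split as `𝔭₁ 𝔭₂` with residue degrees `1, 2` -/

open Summit.Langlands.Langlands.Theses.SplitPrimeInduction (MonomialSerreAtSplitPrimes) in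
/-- **`MonomialSerreAtSplitPrimes` fails for any cubic field `F` with `r₁(F) ≤ 1`, an odd prime `p`
completely split in `F` (in the crux's own typing: `e = f = 1` at every place over `p`) and a modulus
`M₀ > 0` and bound `B₀` such that every prime `ℓ > B₀`, `ℓ ≡ -1 (mod M₀)`, has EXACTLY two places of
`F` above the place of `ℚ` containing `ℓ`, of residue degrees `1` and `2` over `𝓞 ℚ`** (true for
`F = ℚ(∛2)`, `p = 31`, `M₀ = 3`: `x³ - 2 ≡ (x-4)(x-7)(x-20) (mod 31)`, and for `ℓ ≡ 2 (mod 3)` cubing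
is a bijection of `𝔽_ℓ`, so `x³ - 2 ≡ (x - r)·(irreducible quadratic)`; Dedekind–Kummer).
PROOF.  Apply the crux to the TRIVIAL character `χ = 1` of `Γ_F` (`c ≡ 1`, `Sχ = ∅`; coefficients
`k = 𝔽̄_p` discrete); let `K'` (open) and `e ≠ 0` be the asserted level and eigenclass.  Openness of
`K'` gives finitely many places `I` and congruence exponents `N_v` such that every scalar idèle `y·1`,
`y, y⁻¹` integral with `y ≡ 1 (mod 𝔭_v^{N_v})` on `I`, lies in `K'`.  Dirichlet gives a prime
`ℓ ≡ -1 (mod p·M₀·∏_{v ∈ I ∪ S'} q_v^{N_v+1})`, so the place `v = (ℓ)` avoids `S' ∪ I`.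
(A) CENTRAL SIGN: the top Hecke element `t_{v,3} = ϖ_v·1` is the scalar of the idèle `ϖ_v = (-ℓ)·y`,
`y = (-ℓ)⁻¹ϖ_v` with `y·1 ∈ K'`; so `T^{(3)}_v = T_{(-ℓ)·1} = id` on `H^{i'}(X_{K'}, k)` (a central
element of `GL₃(ℚ)` acts trivially on group cohomology), whence `b_{v,3} = 1`.
(B) SPLITTING: `(ℓ)` has two places above it with `f = 1, 2`, so the asserted identity reads
`1 - … - ℓ⁶ b_{v,3} X³ = (1 - X)(1 - X²)`, i.e. `-ℓ⁶ b_{v,3} = 1`; with `ℓ ≡ -1 (mod p)` and `b_{v,3} = 1`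
this is `-1 = 1` in `k`, contradicting `p ≠ 2`. [folklore] -/
theorem monomialSerreAtSplitPrimes_false_of_cubicField (F : Type) [Field F] [NumberField F]
    (hd3 : Module.finrank ℚ F = 3) (hr1 : InfinitePlace.nrRealPlaces F ≤ 1) {p : ℕ} (hp : p.Prime)
    (hp2 : p ≠ 2)
    (hsplit : ∀ v : HeightOneSpectrum (𝓞 F), ((p : ℕ) : 𝓞 F) ∈ v.asIdeal →
      v.asIdeal.ramificationIdx ℤ = 1 ∧ v.asIdeal.inertiaDeg ℤ = 1)
    {M₀ B₀ : ℕ} (hM₀ : 0 < M₀)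
    (hH : ∀ ℓ : ℕ, ℓ.Prime → B₀ < ℓ → M₀ ∣ ℓ + 1 →
      ∀ v : HeightOneSpectrum (𝓞 ℚ), ((ℓ : ℕ) : 𝓞 ℚ) ∈ v.asIdeal →
        ∃ w₁ w₂ : HeightOneSpectrum (𝓞 F), w₁ ≠ w₂ ∧
          {w : HeightOneSpectrum (𝓞 F) | w.asIdeal.under (𝓞 ℚ) = v.asIdeal} = {w₁, w₂} ∧
          w₁.asIdeal.inertiaDeg (𝓞 ℚ) = 1 ∧ w₂.asIdeal.inertiaDeg (𝓞 ℚ) = 2) :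
    ¬ MonomialSerreAtSplitPrimes := by
  intro hcrux
  haveI : Fact p.Prime := ⟨hp⟩
  -- coefficients `k = 𝔽̄_p`, discrete
  let k : Type := AlgebraicClosure (ZMod p)
  letI : TopologicalSpace k := ⊥
  haveI : DiscreteTopology k := ⟨rfl⟩
  have hχ : ∀ w ∉ (∅ : Finset (HeightOneSpectrum (𝓞 F))), (1 : FramedGaloisRep F k 1).IsUnramifiedAt w ∧
      (1 : FramedGaloisRep F k 1).HasFrobCharpolyAt w (X - C ((fun _ => (1 : k)) w)) :=
    fun w _ => trivial_unramified_frobOne F k w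
  obtain ⟨S', K', ϖ', i', b, hϖ', hK'o, -, -, ⟨e, he0, heig⟩, hpoly⟩ :=
    hcrux F (by omega) hr1 p hp2 hsplit k (1 : FramedGaloisRep F k 1) ∅ (fun _ => 1) hχ
  -- the neighbourhood of `1` inside `K'`
  obtain ⟨I, hI, γ, hγ0, hK'nbhd⟩ := exists_forall_scalar_mem ℚ hK'o K'.one_mem
  -- congruence exponents
  let N : HeightOneSpectrum (𝓞 ℚ) → ℕ := fun v => (1 - WithZero.log (γ v)).toNat
  have hN : ∀ v, WithZero.exp (-(N v : ℤ)) < γ v := by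
    intro v
    rw [← WithZero.lt_log_iff_exp_lt (hγ0 v)]
    have := Int.self_le_toNat (1 - WithZero.log (γ v))
    simp only [N]
    omega
  -- the modulus and the Dirichlet prime
  let T : Finset (HeightOneSpectrum (𝓞 ℚ)) := hI.toFinset ∪ S'
  let Mod : ℕ := p * M₀ * ∏ v ∈ T, v.residueCard ^ (N v + 1)
  have hMod0 : Mod ≠ 0 := by
    refine mul_ne_zero (mul_ne_zero hp.ne_zero hM₀.ne') (Finset.prod_ne_zero_iff.2 fun v _ => ?_)
    exact pow_ne_zero _ (by have := v.one_lt_residueCard; omega)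
  haveI : NeZero Mod := ⟨hMod0⟩
  obtain ⟨ℓ, hℓB, hℓ, hℓmod⟩ :=
    Nat.forall_exists_prime_gt_and_eq_mod (isUnit_one.neg : IsUnit (-1 : ZMod Mod)) B₀
  have hdvd : Mod ∣ ℓ + 1 := by
    rw [← ZMod.natCast_eq_zero_iff]
    push_cast
    rw [hℓmod, neg_add_cancel]
  have hM₀dvd : M₀ ∣ ℓ + 1 := (Dvd.intro_left _ rfl : M₀ ∣ p * M₀).trans ((Dvd.intro _ rfl).trans hdvd)
  have hpdvd : p ∣ ℓ + 1 := (Dvd.intro _ rfl : p ∣ p * M₀).trans ((Dvd.intro _ rfl).trans hdvd)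
  have hTdvd : ∀ v ∈ T, v.residueCard ^ (N v + 1) ∣ ℓ + 1 := fun v hv =>
    ((Finset.dvd_prod_of_mem _ hv).trans (Dvd.intro_left _ rfl)).trans hdvd
  -- the place `v = (ℓ)`; it avoids `S'` and `I`
  let v : HeightOneSpectrum (𝓞 ℚ) := HeightOneSpectrum.ofPrime (prime_span_natCast hℓ)
  have hv : v.asIdeal = Ideal.span {(ℓ : 𝓞 ℚ)} := rfl
  have hvT : v ∉ T := by
    intro hvT
    have h1 : ℓ ∣ ℓ + 1 := by
      have := hTdvd v hvT
      rw [residueCard_eq_of_asIdeal_eq hv, pow_succ] at this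
      exact (Dvd.intro_left _ rfl).trans this
    exact hℓ.ne_one (Nat.dvd_one.1 ((Nat.dvd_add_right (dvd_refl ℓ)).1 h1))
  have hvS' : v ∉ S' := fun h => hvT (Finset.mem_union_right _ h)
  have hvI : v ∉ I := fun h => hvT (Finset.mem_union_left _ (hI.mem_toFinset.2 h))
  -- the rational unit `r = -ℓ` and the test idèle `y = r⁻¹ ϖ'_v`
  let r : ℚˣ := Units.mk0 (-(ℓ : ℚ)) (neg_ne_zero.2 (by exact_mod_cast hℓ.ne_zero))
  have hr : (r : ℚ) = -(ℓ : ℚ) := rfl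
  -- (A) the top Hecke operator at `v` is the identity, so `b v 3 = 1`
  have hyK : Matrix.GeneralLinearGroup.scalar (Fin (Module.finrank ℚ F))
      ((Units.map (algebraMap ℚ (FiniteAdeleRing (𝓞 ℚ) ℚ) : ℚ →* FiniteAdeleRing (𝓞 ℚ) ℚ) r)⁻¹ *
        uniformizerIdele ℚ v (ϖ' v)) ∈ K' := by
    refine hK'nbhd _ (testIdele_integral hℓ hv (ϖ' v) hr (hϖ' v)) fun w hw => ?_
    have hwv : w ≠ v := fun h => hvI (h ▸ hw)
    have hwT : w ∈ T := Finset.mem_union_left _ (hI.mem_toFinset.2 hw)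
    have hmem : ((ℓ + 1 : ℕ) : 𝓞 ℚ) ∈ w.asIdeal ^ (N w + 1) := by
      obtain ⟨c, hc⟩ := hTdvd w hwT
      rw [hc, Nat.cast_mul, Nat.cast_pow]
      exact Ideal.mul_mem_right _ _ (Ideal.pow_mem_pow (Ideal.absNorm_mem w.asIdeal) _)
    obtain ⟨h₁, h₂⟩ := testIdele_close hℓ hv (ϖ' v) hr hwv hmem
    have hlt : WithZero.exp (-((N w + 1 : ℕ) : ℤ)) < γ w :=
      lt_of_le_of_lt (WithZero.exp_le_exp.2 (by push_cast; omega)) (hN w)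
    exact ⟨h₁.trans_lt hlt, h₂.trans_lt hlt⟩
  have hT3 : ArithmeticQuotient.heckeEnd k K' (GLn.sndHom (Module.finrank ℚ F) ℚ
      (heckeDiagAt (Module.finrank ℚ F) ℚ v (ϖ' v) (Module.finrank ℚ F))) k
      (Matrix.GeneralLinearGroup.map (algebraMap ℚ (FiniteAdeleRing (𝓞 ℚ) ℚ))) i' e = e := by
    have hcoset : ((GLn.sndHom (Module.finrank ℚ F) ℚ
        (heckeDiagAt (Module.finrank ℚ F) ℚ v (ϖ' v) (Module.finrank ℚ F)) :
        GL (Fin (Module.finrank ℚ F)) (FiniteAdeleRing (𝓞 ℚ) ℚ)) :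
          GL (Fin (Module.finrank ℚ F)) (FiniteAdeleRing (𝓞 ℚ) ℚ) ⧸ K') =
        ((Matrix.GeneralLinearGroup.map (algebraMap ℚ (FiniteAdeleRing (𝓞 ℚ) ℚ))
          (Matrix.GeneralLinearGroup.scalar (Fin (Module.finrank ℚ F)) r) :
            GL (Fin (Module.finrank ℚ F)) (FiniteAdeleRing (𝓞 ℚ) ℚ)) :
            GL (Fin (Module.finrank ℚ F)) (FiniteAdeleRing (𝓞 ℚ) ℚ) ⧸ K') := by
      rw [sndHom_heckeDiagAt_self, uniformizerIdele_eq_mul r (ϖ' v), map_mul,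
        Matrix.GeneralLinearGroup.map_scalar]
      exact QuotientGroup.mk_mul_of_mem _ hyK
    rw [heckeEnd_eq_of_coe_eq (Matrix.GeneralLinearGroup.map (algebraMap ℚ (FiniteAdeleRing (𝓞 ℚ) ℚ)))
      K' hcoset i']
    exact heckeEnd_principalScalar_apply (Module.finrank ℚ F) ℚ k K' k r i' e
  have hb3 : b v (Module.finrank ℚ F) = 1 := by
    have h := heig v hvS' (Module.finrank ℚ F) (by omega) le_rfl
    rw [hT3] at h
    by_contra hb
    apply he0
    have h' : (b v (Module.finrank ℚ F) - 1) • e = 0 := by rw [sub_smul, one_smul, ← h, sub_self]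
    rcases smul_eq_zero.1 h' with h'' | h''
    · exact absurd (sub_eq_zero.1 h'') hb
    · exact h''
  -- (B) the polynomial identity at `v`: two places above `(ℓ)` of degrees `1` and `2`
  obtain ⟨w₁, w₂, hne, hset, hf₁, hf₂⟩ := hH ℓ hℓ hℓB hM₀dvd v (natCast_mem_of_asIdeal_eq hv)
  have hP := (hpoly v hvS').2
  rw [hset, finprod_mem_pair hne, hf₁, hf₂] at hP
  have h3 := congrArg (fun P : Polynomial k => P.coeff 3) hP
  rw [coeff_three_oneSubX_mul, hd3, coeff_three_heckePoly, ← hd3, hb3, mul_one,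
    residueCard_eq_of_asIdeal_eq hv] at h3
  -- `ℓ ≡ -1 (mod p)` in `k`
  have hℓk : (ℓ : k) = -1 := by
    have h0 : ((ℓ + 1 : ℕ) : k) = 0 := (CharP.cast_eq_zero_iff k p _).2 hpdvd
    push_cast at h0
    exact eq_neg_of_add_eq_zero_left h0
  rw [hℓk] at h3
  -- `-1 = 1` in `k`: contradiction with `p ≠ 2`
  apply two_ne_zero_of_charP k p hp2
  linear_combination -h3

end Summit.Langlands.Langlands.Theorems.MonomialSerreAtSplitPrimes.Negative

end
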